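import Mathlib.Combinatorics.SetFamily.FourFunctions
import Literature.Probability.LatticeModels.RandomClusterFKG
import HarnessLib

/-!
# The comparison inequality (3.22) for the random-cluster model, proved

Topic `Literature/Probability/LatticeModels`. Grimmett 2006, Thm. (3.21) (comparison
inequalities, Fortuin 1972 [122]), first inequality (3.22): for a finite graph `G`,
`φ_{p₁,q₁} ≤_st φ_{p₂,q₂}` if `q₁ ≥ q₂`, `q₁ ≥ 1` and `p₁ ≤ p₂`. Proved here for the tree's
finite-graph measure `rcMeasure G p q B` with an arbitrary wired vertex set `B` (the wiring
only changes the cluster count `k^B`, which is still antitone and supermodular), in the form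
used everywhere in the book: `φ^B_{G,p₁,q₁}(A) ≤ φ^B_{G,p₂,q₂}(A)` for every increasing event
`A` (`rcMeasure_real_mono_of_isUpperSet`; `0 < q₂` is assumed so that `φ_{p₂,q₂}` is a
probability measure). In particular `p ↦ φ^B_{G,p,q}(A)` is non-decreasing on `[0, 1]` for
`q ≥ 1` (`rcMeasure_real_mono_left`), and `φ^B_{G,p,q}(A) ≤ φ^B_{G,p,q'}(A)` for
`1 ≤ q' ≤ q` (`rcMeasure_real_anti_right`; comparison with smaller `q`, e.g. with Bernoulli
percolation `q' = 1`).

Proof as in Grimmett 2006, proof of Thm. (3.21), first alternative ("We may either apply the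
Holley inequality (Theorem 2.1) …"): the pair of weights
`w_i(ω) = p_i^{|ω|} (1-p_i)^{|E∖ω|} q_i^{k^B(ω)}` satisfies Holley's condition
`w₁(a) w₂(b) ≤ w₁(a ∧ b) w₂(a ∨ b)` (`rcWeight_holley_condition`): the `p`-part because
`p₁(1-p₂) ≤ p₂(1-p₁)`, the `q`-part because `k^B` is antitone (`clusterCount_anti`) and
supermodular (`clusterCount_supermodular`, from `RandomClusterFKG`) and `q₂ ≤ q₁`, `1 ≤ q₁`;
Mathlib's `holley` (Holley 1974, on the finite distributive lattice `Finset (Sym2 V)`) then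
compares the expectations of the increasing indicator of `A`.

## References

* G. Grimmett, *The Random-Cluster Model*, Springer 2006, §3.4, Thm. (3.21), eqs. (3.22)–(3.23)
  and the proof following Thm. (3.24); Thm. (2.1) (Holley inequality).
* C. M. Fortuin, *On the random-cluster model. III. The simple random-cluster model*, Physica 59
  (1972) 545–570 (Grimmett's [122]).
* R. Holley, *Remarks on the FKG inequalities*, Comm. Math. Phys. 36 (1974) 227–231.
* Mathlib: `Mathlib.Combinatorics.SetFamily.FourFunctions` (`holley`),
  `SimpleGraph.ConnectedComponent.card_le_card_of_le`.
-/

noncomputable section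

open MeasureTheory Finset SimpleGraph

namespace Literature.Probability.LatticeModels

/-! ### The cluster count is antitone -/

section ClusterCount

variable {V : Type*} [Finite V]

/-- Opening edges can only merge clusters: `ω₁ ⊆ ω₂ ⇒ k^B(ω₂) ≤ k^B(ω₁)` (Grimmett 2006, §3.4,
"`k(ω)` is a decreasing function of `ω`"). [cite: Grimmett2006, Thm. (3.21) (proof)] -/
theorem clusterCount_anti {ω₁ ω₂ : Percolation.BondConfig V} (h : ω₁ ⊆ ω₂) (B : Set V) :
    clusterCount ω₂ B ≤ clusterCount ω₁ B := by
  unfold clusterCount Percolation.openGraph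
  exact ConnectedComponent.card_le_card_of_le (sup_le_sup_right (fromEdgeSet_mono h) _)

end ClusterCount

/-! ### Holley's condition for a pair of random-cluster weights -/

/-- The arithmetic heart of the comparison inequality (3.22): with `0 ≤ p₁ ≤ p₂ ≤ 1`,
`0 ≤ q₂ ≤ q₁`, `1 ≤ q₁`, exponents `|a| = nᵢ + m`, `|a ∨ b| = n_b + m`, `|E∖(a∧b)| = c_a + m`,
`|E∖b| = c_u + m` and cluster counts `k(a) ≤ k(a∧b)`, `k(a∨b) ≤ k(b)`,
`k(a) + k(b) ≤ k(a∧b) + k(a∨b)`, one has `w₁(a) w₂(b) ≤ w₁(a∧b) w₂(a∨b)`.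
[cite: Grimmett2006, Thm. (3.21) (proof)] -/
theorem rcWeight_holley_aux {p₁ p₂ q₁ q₂ : ℝ} (hp₁ : 0 ≤ p₁) (hp : p₁ ≤ p₂) (hp₂ : p₂ ≤ 1)
    (hq₂ : 0 ≤ q₂) (hq : q₂ ≤ q₁) (hq₁ : 1 ≤ q₁) {ni nb ca cu m ka kb ki ku : ℕ}
    (hki : ka ≤ ki) (hku : ku ≤ kb) (hk : ka + kb ≤ ki + ku) :
    p₁ ^ (ni + m) * (1 - p₁) ^ ca * q₁ ^ ka * (p₂ ^ nb * (1 - p₂) ^ (cu + m) * q₂ ^ kb) ≤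
      p₁ ^ ni * (1 - p₁) ^ (ca + m) * q₁ ^ ki * (p₂ ^ (nb + m) * (1 - p₂) ^ cu * q₂ ^ ku) := by
  obtain ⟨s, rfl⟩ := Nat.exists_eq_add_of_le hki
  obtain ⟨t, rfl⟩ := Nat.exists_eq_add_of_le hku
  have hts : t ≤ s := by omega
  have h1p₁ : 0 ≤ 1 - p₁ := by linarith
  have h1p₂ : 0 ≤ 1 - p₂ := by linarith
  have hp₂0 : 0 ≤ p₂ := hp₁.trans hp
  have hq₁0 : 0 ≤ q₁ := hq₂.trans hq
  set C := p₁ ^ ni * (1 - p₁) ^ ca * q₁ ^ ka * (p₂ ^ nb * (1 - p₂) ^ cu * q₂ ^ ku) with hC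
  have hC0 : 0 ≤ C := by positivity
  have hbase : p₁ * (1 - p₂) ≤ p₂ * (1 - p₁) := by nlinarith
  have key : (p₁ * (1 - p₂)) ^ m * q₂ ^ t ≤ (p₂ * (1 - p₁)) ^ m * q₁ ^ s :=
    mul_le_mul (pow_le_pow_left₀ (mul_nonneg hp₁ h1p₂) hbase m)
      ((pow_le_pow_left₀ hq₂ hq t).trans (pow_le_pow_right₀ hq₁ hts)) (pow_nonneg hq₂ t)
      (pow_nonneg (mul_nonneg hp₂0 h1p₁) m)
  calc p₁ ^ (ni + m) * (1 - p₁) ^ ca * q₁ ^ ka * (p₂ ^ nb * (1 - p₂) ^ (cu + m) * q₂ ^ (ku + t))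
      = C * ((p₁ * (1 - p₂)) ^ m * q₂ ^ t) := by simp only [hC, pow_add, mul_pow]; ring
    _ ≤ C * ((p₂ * (1 - p₁)) ^ m * q₁ ^ s) := mul_le_mul_of_nonneg_left key hC0
    _ = p₁ ^ ni * (1 - p₁) ^ (ca + m) * q₁ ^ (ka + s) *
          (p₂ ^ (nb + m) * (1 - p₂) ^ cu * q₂ ^ ku) := by simp only [hC, pow_add, mul_pow]; ring

section Finite

variable {V : Type*} [Fintype V] [DecidableEq V] (G : SimpleGraph V) [DecidableRel G.Adj]

/-- **Holley's condition for two random-cluster weights** (Grimmett 2006, proof of Thm. (3.21)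
via Thm. (2.1)): for `0 ≤ p₁ ≤ p₂ ≤ 1`, `0 ≤ q₂ ≤ q₁`, `1 ≤ q₁` and any wired set `B`, the
weights `wᵢ = p_i^{|ω|} (1-p_i)^{|E∖ω|} q_i^{k^B(ω)}` (extended by `0` off the edge sets of `G`)
satisfy `w₁(a) w₂(b) ≤ w₁(a ∧ b) w₂(a ∨ b)`. [cite: Grimmett2006, Thm. (3.21) (proof)] -/
theorem rcWeight_holley_condition {p₁ p₂ q₁ q₂ : ℝ} (hp₁ : p₁ ∈ Set.Icc (0 : ℝ) 1)
    (hp₂ : p₂ ∈ Set.Icc (0 : ℝ) 1) (hp : p₁ ≤ p₂) (hq₂ : 0 ≤ q₂) (hq : q₂ ≤ q₁) (hq₁ : 1 ≤ q₁)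
    (B : Set V) (a b : Finset (Sym2 V)) :
    (if a ⊆ G.edgeFinset then rcWeight G p₁ q₁ B a else 0) *
        (if b ⊆ G.edgeFinset then rcWeight G p₂ q₂ B b else 0) ≤
      (if a ⊓ b ⊆ G.edgeFinset then rcWeight G p₁ q₁ B (a ⊓ b) else 0) *
        (if a ⊔ b ⊆ G.edgeFinset then rcWeight G p₂ q₂ B (a ⊔ b) else 0) := by
  have hq₁0 : 0 ≤ q₁ := hq₂.trans hq
  by_cases ha : a ⊆ G.edgeFinset
  swap
  · rw [if_neg ha, zero_mul]
    exact mul_nonneg (rcWeight_ite_nonneg G hp₁ hq₁0 B _) (rcWeight_ite_nonneg G hp₂ hq₂ B _)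
  by_cases hb : b ⊆ G.edgeFinset
  swap
  · rw [if_neg hb, mul_zero]
    exact mul_nonneg (rcWeight_ite_nonneg G hp₁ hq₁0 B _) (rcWeight_ite_nonneg G hp₂ hq₂ B _)
  have hab : a ⊓ b ⊆ G.edgeFinset := Finset.inter_subset_left.trans ha
  have hab' : a ⊔ b ⊆ G.edgeFinset := Finset.union_subset ha hb
  rw [if_pos ha, if_pos hb, if_pos hab, if_pos hab']
  simp only [rcWeight]
  -- the exponents of `p` and `1 - p`
  have h1 : #(a ⊓ b) ≤ #a := card_le_card inf_le_left
  have h2 : #a + #b = #(a ⊓ b) + #(a ⊔ b) := by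
    rw [Finset.inf_eq_inter, Finset.sup_eq_union, add_comm (#(a ∩ b)),
      Finset.card_union_add_card_inter]
  have h3 : #(G.edgeFinset \ a) = #G.edgeFinset - #a := card_sdiff_of_subset ha
  have h4 : #(G.edgeFinset \ b) = #G.edgeFinset - #b := card_sdiff_of_subset hb
  have h5 : #(G.edgeFinset \ (a ⊓ b)) = #G.edgeFinset - #(a ⊓ b) := card_sdiff_of_subset hab
  have h6 : #(G.edgeFinset \ (a ⊔ b)) = #G.edgeFinset - #(a ⊔ b) := card_sdiff_of_subset hab'
  have h7 : #a ≤ #G.edgeFinset := card_le_card ha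
  have h8 : #(a ⊔ b) ≤ #G.edgeFinset := card_le_card hab'
  obtain ⟨m, hm⟩ : ∃ m, #a = #(a ⊓ b) + m := Nat.exists_eq_add_of_le h1
  have hu : #(a ⊔ b) = #b + m := by omega
  have hca : #(G.edgeFinset \ (a ⊓ b)) = #(G.edgeFinset \ a) + m := by omega
  have hcb : #(G.edgeFinset \ b) = #(G.edgeFinset \ (a ⊔ b)) + m := by omega
  rw [hm, hu, hca, hcb]
  -- the exponents of `q`
  have hki : clusterCount (↑a : Percolation.BondConfig V) B ≤
      clusterCount (↑(a ⊓ b) : Percolation.BondConfig V) B :=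
    clusterCount_anti (by rw [Finset.inf_eq_inter, Finset.coe_inter]; exact Set.inter_subset_left) B
  have hku : clusterCount (↑(a ⊔ b) : Percolation.BondConfig V) B ≤
      clusterCount (↑b : Percolation.BondConfig V) B :=
    clusterCount_anti
      (by rw [Finset.sup_eq_union, Finset.coe_union]; exact Set.subset_union_right) B
  have hk : clusterCount (↑a : Percolation.BondConfig V) B +
      clusterCount (↑b : Percolation.BondConfig V) B ≤
      clusterCount (↑(a ⊓ b) : Percolation.BondConfig V) B +
        clusterCount (↑(a ⊔ b) : Percolation.BondConfig V) B := by
    rw [Finset.inf_eq_inter, Finset.sup_eq_union, Finset.coe_inter, Finset.coe_union]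
    exact clusterCount_supermodular _ _ B
  exact rcWeight_holley_aux hp₁.1 hp hp₂.2 hq₂ hq hq₁ hki hku hk

/-- **Comparison inequality (3.22), proved** (Grimmett 2006, Thm. (3.21); Fortuin 1972): for a
finite graph `G`, any wired set `B`, `0 ≤ p₁ ≤ p₂ ≤ 1`, `0 < q₂ ≤ q₁`, `1 ≤ q₁`, and every
increasing event `A` (Mathlib `IsUpperSet` for inclusion of edge sets),
`φ^B_{G,p₁,q₁}(A) ≤ φ^B_{G,p₂,q₂}(A)`, i.e. `φ_{p₁,q₁} ≤_st φ_{p₂,q₂}` tested on increasing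
events. From Holley's inequality (Mathlib `holley`) and `rcWeight_holley_condition`.
[cite: Grimmett2006, Thm. (3.21), eq. (3.22)] -/
theorem rcMeasure_real_mono_of_isUpperSet {p₁ p₂ q₁ q₂ : ℝ} (hp₁ : p₁ ∈ Set.Icc (0 : ℝ) 1)
    (hp₂ : p₂ ∈ Set.Icc (0 : ℝ) 1) (hp : p₁ ≤ p₂) (hq₂ : 0 < q₂) (hq : q₂ ≤ q₁) (hq₁ : 1 ≤ q₁)
    (B : Set V) {A : Set (Percolation.BondConfig V)} (hA : IsUpperSet A) :
    (rcMeasure G p₁ q₁ B).real A ≤ (rcMeasure G p₂ q₂ B).real A := by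
  classical
  have hq₁' : 0 < q₁ := hq₂.trans_le hq
  have hZ₁ := rcPartitionFunction_pos G hp₁ hq₁' B
  have hZ₂ := rcPartitionFunction_pos G hp₂ hq₂ B
  set f : Finset (Sym2 V) → ℝ := fun ω ↦
    (if ω ⊆ G.edgeFinset then rcWeight G p₁ q₁ B ω else 0) / rcPartitionFunction G p₁ q₁ B with hf
  set g : Finset (Sym2 V) → ℝ := fun ω ↦
    (if ω ⊆ G.edgeFinset then rcWeight G p₂ q₂ B ω else 0) / rcPartitionFunction G p₂ q₂ B with hg
  set μ : Finset (Sym2 V) → ℝ := fun ω ↦ if (↑ω : Percolation.BondConfig V) ∈ A then 1 else 0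
    with hμ
  have hf0 : 0 ≤ f := fun ω ↦ div_nonneg (rcWeight_ite_nonneg G hp₁ hq₁'.le B ω) hZ₁.le
  have hg0 : 0 ≤ g := fun ω ↦ div_nonneg (rcWeight_ite_nonneg G hp₂ hq₂.le B ω) hZ₂.le
  have hμ0 : 0 ≤ μ := fun ω ↦ by simp only [hμ, Pi.zero_apply]; split_ifs <;> norm_num
  have hμm : Monotone μ := by
    intro a b hab
    simp only [hμ]
    by_cases ha : (↑a : Percolation.BondConfig V) ∈ A
    · have hb : (↑b : Percolation.BondConfig V) ∈ A := hA (Finset.coe_subset.2 hab) ha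
      simp [ha, hb]
    · simp only [ha, if_false]; split_ifs <;> norm_num
  -- sums over the lattice of all edge sets are sums over the edge sets of `G`
  have hfilter : (Finset.univ : Finset (Finset (Sym2 V))).filter (· ⊆ G.edgeFinset) =
      G.edgeFinset.powerset := by
    ext ω; simp
  have hsum : ∀ (p q : ℝ) (F : Finset (Sym2 V) → ℝ),
      ∑ ω, F ω * ((if ω ⊆ G.edgeFinset then rcWeight G p q B ω else 0) /
        rcPartitionFunction G p q B) =
        ∑ ω ∈ G.edgeFinset.powerset, F ω * (rcWeight G p q B ω / rcPartitionFunction G p q B) := by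
    intro p q F
    rw [← hfilter, Finset.sum_filter]
    refine Finset.sum_congr rfl fun ω _ ↦ ?_
    split_ifs <;> simp
  have htotal : ∀ (p q : ℝ), p ∈ Set.Icc (0 : ℝ) 1 → 0 < q →
      ∑ ω, (if ω ⊆ G.edgeFinset then rcWeight G p q B ω else 0) / rcPartitionFunction G p q B =
        1 := by
    intro p q hp' hq'
    have h := hsum p q fun _ ↦ 1
    simp only [one_mul] at h
    rw [h, ← Finset.sum_div, ← rcPartitionFunction,
      div_self (rcPartitionFunction_pos G hp' hq' B).ne']
  have hfg : ∑ ω, f ω = ∑ ω, g ω := by rw [hf, hg, htotal p₁ q₁ hp₁ hq₁', htotal p₂ q₂ hp₂ hq₂]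
  have hcond : ∀ a b, f a * g b ≤ f (a ⊓ b) * g (a ⊔ b) := by
    intro a b
    simp only [hf, hg]
    rw [div_mul_div_comm, div_mul_div_comm]
    exact div_le_div_of_nonneg_right (rcWeight_holley_condition G hp₁ hp₂ hp hq₂.le hq hq₁ B a b)
      (mul_pos hZ₁ hZ₂).le
  have key := _root_.holley f g μ hμ0 hf0 hg0 hμm hfg hcond
  -- identify the two sides
  have hreal : ∀ (p q : ℝ), p ∈ Set.Icc (0 : ℝ) 1 → 0 < q →
      (rcMeasure G p q B).real A =
        ∑ ω, μ ω * ((if ω ⊆ G.edgeFinset then rcWeight G p q B ω else 0) /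
          rcPartitionFunction G p q B) := by
    intro p q hp' hq'
    rw [rcMeasure_real_apply G hp' hq' B A, hsum]
    refine Finset.sum_congr rfl fun ω _ ↦ ?_
    simp only [hμ]
    split_ifs <;> simp
  rw [hreal p₁ q₁ hp₁ hq₁', hreal p₂ q₂ hp₂ hq₂]
  exact key

/-- **Monotonicity in `p`** (Grimmett 2006, Thm. (3.21), (3.22) with `q₁ = q₂ = q ≥ 1`): for an
increasing event `A`, `p ↦ φ^B_{G,p,q}(A)` is non-decreasing on `[0, 1]`.
[cite: Grimmett2006, Thm. (3.21), eq. (3.22)] -/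
theorem rcMeasure_real_mono_left {p₁ p₂ q : ℝ} (hp₁ : p₁ ∈ Set.Icc (0 : ℝ) 1)
    (hp₂ : p₂ ∈ Set.Icc (0 : ℝ) 1) (hp : p₁ ≤ p₂) (hq : 1 ≤ q) (B : Set V)
    {A : Set (Percolation.BondConfig V)} (hA : IsUpperSet A) :
    (rcMeasure G p₁ q B).real A ≤ (rcMeasure G p₂ q B).real A :=
  rcMeasure_real_mono_of_isUpperSet G hp₁ hp₂ hp (one_pos.trans_le hq) le_rfl hq B hA

/-- **Monotonicity in `q`** (Grimmett 2006, Thm. (3.21), (3.22) with `p₁ = p₂`): for an increasing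
event `A` and `1 ≤ q' ≤ q`, `φ^B_{G,p,q}(A) ≤ φ^B_{G,p,q'}(A)`; with `q' = 1` this compares the
random-cluster measure with Bernoulli bond percolation of the same edge density.
[cite: Grimmett2006, Thm. (3.21), eq. (3.22)] -/
theorem rcMeasure_real_anti_right {p q q' : ℝ} (hp : p ∈ Set.Icc (0 : ℝ) 1) (hq' : 1 ≤ q')
    (hq : q' ≤ q) (B : Set V) {A : Set (Percolation.BondConfig V)} (hA : IsUpperSet A) :
    (rcMeasure G p q B).real A ≤ (rcMeasure G p q' B).real A :=
  rcMeasure_real_mono_of_isUpperSet G hp hp le_rfl (one_pos.trans_le hq') hq (hq'.trans hq) B hA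

end Finite

end Literature.Probability.LatticeModels

end
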